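import Summits.QuantumFields.YangMills.Theorems.F4SubCurvatureDoorShortRootRigidityOddModePlaneFrame
import Summits.QuantumFields.YangMills.Theorems.F4SubCurvatureDoorShortRootRigidityTrigonalReflection
import Literature.Analysis.Calculus.MvPolynomialFDeriv
import Mathlib
import HarnessLib

/-!
# TorusReduction, part (TR4b): the support condition `EvenPartSliceInvariant` kills the rational rotation generator

Crux ⟨stmt-QuantumFields-23035⟩ `F4SubCurvatureDoor.ShortRootRigidity`, stub `:146 stub_oddModeRigidity`, piece `TorusReduction`
(`Cruxes/ShortRootRigidity/Lines/odd_mode_split.lean`).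

For a polynomial `h ∈ ℝ[x₀,…,x₃]` which is even in `x₀` and whose kernel `toFun h` (= the split vocabulary's `pev h`, definitionally)
satisfies `EvenPartSliceInvariant` (even-part slice
invariance along `Π₀ = span(e₀, (0,1,1,1)/√3)`), the polynomial `A := h + h∘σ̂` (`σ̂ = 1 ⊕ Rf`, `Rf` the reflection of `ℝ³` in `(1,1,1)^⊥`,
encoded by any `4×4` matrix `S` acting as `(t, x⃗) ↦ (t, Rf x⃗)`) is killed by the RATIONAL generator of the rotations of `Π₀`:
`x₀·(∂₁+∂₂+∂₃)A − (x₁+x₂+x₃)·∂₀A = 0` (`generator_eq_zero`).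

Proof: `h(ιy+ι⊥x) + h(−ιy+ι⊥x) = A(ιy+ι⊥x)` (time-evenness turns `−ιy` into `σ̂`); the left side is invariant under `y ↦ R y` for
every plane isometry `R`, in particular along the rotation family `R_θ` (built from `rotation (Circle.exp θ)` on `ℂ ≅ ℝ²`); differentiating
`θ ↦ A(ι(R_θ y)+ι⊥x)` at `θ = 0` with the tree's `hasFDerivAt_toFun` gives `Σᵢ Wᵢ ∂ᵢA = 0` with `W = ι(−y₁, y₀) = (−s, t, t, t)/√3`, i.e. the
generator identity at every point of `ℝ⁴ = ι(ℝ²) ⊕ ι⊥(ℝ²)`, hence as a polynomial identity.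

Mathlib + tree only; no `sorry`; no new definitions.  HONEST LABEL: one step of one piece of the OPEN stub `:146`; ⟨23035⟩, ⟨23125⟩, R2d and
the Yang–Mills mass gap remain OPEN; no summit is proved by a line.  LEAD seat `ym-line-sfw-p2` g76 (cell ym-idea-1, free hands).
-/

noncomputable section

open MvPolynomial
open scoped BigOperators

namespace Summit.QuantumFields.YangMills.Theorems.F4SubCurvatureDoorTorus

open Literature.Analysis.Calculus.MvPoly (toFun toFun_apply hasFDerivAt_toFun derivCLM_apply)
open Literature.Algebra.Polynomial (linSubst eval_bind₁_linSubst)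
open Summit.QuantumFields.YangMills.Theorems.F4SubCurvatureDoorMirrorAnalyticityRegistered (E4)
open Summit.QuantumFields.YangMills.Theorems.F4SubCurvatureDoorSliceDensityRegistered (E2 planeEmb perpEmb EvenPartSliceInvariant
  planeEmb_add_perpEmb_apply_zero planeEmb_add_perpEmb_apply_one planeEmb_add_perpEmb_apply_two planeEmb_add_perpEmb_apply_three)
open Summit.QuantumFields.YangMills.Theorems.F4SubCurvatureDoorAnalyticHalfProof (planeEmb_add planeEmb_smul planeEmb_apply perpEmb_apply
  exists_planeEmb_add_perpEmb)
open Summit.QuantumFields.YangMills.Theorems.F4SubCurvatureDoorTrigonalLine (Rf Rf_mulVec)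

/-! ## The rotation family of `ℝ²` -/

/-- The rotation by `θ` of `ℝ²`, transported from `rotation (Circle.exp θ)` on `ℂ`, acts by `y ↦ cos θ·y + sin θ·(−y₁, y₀)`. -/
theorem rotation_family_apply (θ : ℝ) (y : E2) :
    ((Complex.orthonormalBasisOneI.repr.symm.trans (rotation (Circle.exp θ))).trans Complex.orthonormalBasisOneI.repr) y =
      Real.cos θ • y + Real.sin θ • (WithLp.equiv 2 (Fin 2 → ℝ)).symm ![-y 1, y 0] := by
  ext i
  simp only [LinearIsometryEquiv.trans_apply, Complex.orthonormalBasisOneI_repr_symm_apply, rotation_apply, Circle.coe_exp,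
    Complex.orthonormalBasisOneI_repr_apply, Complex.exp_mul_I]
  fin_cases i <;>
    simp [Complex.mul_re, Complex.mul_im, Complex.cos_ofReal_re, Complex.sin_ofReal_re, Complex.cos_ofReal_im,
      Complex.sin_ofReal_im]
  ring

/-! ## Frame coordinates -/

/-- The spatial coordinates of `perpEmb x` sum to zero. -/
theorem perpEmb_sum (y x : E2) :
    (planeEmb y + perpEmb x) 1 + (planeEmb y + perpEmb x) 2 + (planeEmb y + perpEmb x) 3 = 3 * (y 1 / Real.sqrt 3) := by
  rw [planeEmb_add_perpEmb_apply_one, planeEmb_add_perpEmb_apply_two, planeEmb_add_perpEmb_apply_three]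
  ring

/-- Coordinates of `−ιy + ι⊥x` versus `ιy + ι⊥x`: time flips, and the spatial part is reflected by `Rf`. -/
theorem neg_planeEmb_add_perpEmb_coords (y x : E2) (S : Matrix (Fin 4) (Fin 4) ℝ)
    (hS : ∀ (t : ℝ) (v : Fin 3 → ℝ), S.mulVec (Fin.cons t v) = Fin.cons t (Rf.mulVec v)) :
    (fun i => if i = 0 then -((-planeEmb y + perpEmb x : E4) i) else (-planeEmb y + perpEmb x : E4) i) =
      S.mulVec (fun i => (planeEmb y + perpEmb x : E4) i) := by
  have hsplit : (fun i => (planeEmb y + perpEmb x : E4) i) =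
      Fin.cons ((planeEmb y + perpEmb x : E4) 0) (fun j : Fin 3 => (planeEmb y + perpEmb x : E4) (Fin.succ j)) := by
    funext i; refine Fin.cases ?_ (fun j => ?_) i <;> rfl
  rw [hsplit, hS, Rf_mulVec]
  have h3 : (planeEmb y + perpEmb x : E4) (Fin.succ 0) + (planeEmb y + perpEmb x : E4) (Fin.succ 1) +
      (planeEmb y + perpEmb x : E4) (Fin.succ 2) = 3 * (y 1 / Real.sqrt 3) := perpEmb_sum y x
  funext i
  refine Fin.cases ?_ (fun j => ?_) i
  · simp [planeEmb_apply, perpEmb_apply]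
  · simp only [Fin.cons_succ, Fin.succ_ne_zero, if_false, h3]
    fin_cases j
    · simp [planeEmb_apply, perpEmb_apply]; ring
    · simp [planeEmb_apply, perpEmb_apply]; ring
    · simp [planeEmb_apply, perpEmb_apply]; ring

/-! ## The generator identity -/

/-- **`EvenPartSliceInvariant` kills the rational rotation generator.**  `h` even in `x₀`, `toFun h` even-part slice invariant, `S` a matrix acting as
`1 ⊕ Rf`; then `A := h + h∘S` satisfies `x₀·(∂₁+∂₂+∂₃)A − (x₁+x₂+x₃)·∂₀A = 0`. -/
theorem generator_eq_zero (h : MvPolynomial (Fin 4) ℝ) (S : Matrix (Fin 4) (Fin 4) ℝ)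
    (hS : ∀ (t : ℝ) (v : Fin 3 → ℝ), S.mulVec (Fin.cons t v) = Fin.cons t (Rf.mulVec v))
    (hτ : ∀ x : Fin 4 → ℝ, eval (fun i => if i = 0 then -x i else x i) h = eval x h)
    (hE : EvenPartSliceInvariant (toFun h)) :
    X 0 * (∑ j : Fin 3, pderiv (Fin.succ j) (h + bind₁ (linSubst S) h)) -
      (∑ j : Fin 3, X (Fin.succ j)) * pderiv 0 (h + bind₁ (linSubst S) h) = 0 := by
  set A : MvPolynomial (Fin 4) ℝ := h + bind₁ (linSubst S) h with hA
  -- (1) the symmetrised slice is the kernel of `A` along the frame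
  have hsum : ∀ y x : E2, toFun h (planeEmb y + perpEmb x) + toFun h (-planeEmb y + perpEmb x) = toFun A (planeEmb y + perpEmb x) := by
    intro y x
    simp only [toFun_apply, hA, map_add, eval_bind₁_linSubst]
    rw [← neg_planeEmb_add_perpEmb_coords y x S hS, hτ]
  -- it suffices to check the identity at every point `ιy + ι⊥x` of `ℝ⁴`
  refine MvPolynomial.funext fun x0 => ?_
  rw [map_zero]
  obtain ⟨y, x, hw⟩ := exists_planeEmb_add_perpEmb (WithLp.toLp 2 x0 : E4)
  set P : E4 := planeEmb y + perpEmb x with hP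
  have hx0 : (fun i => P i) = x0 := by
    funext i
    show P i = x0 i
    rw [← hw]
  -- (2) the rotation curve through `P`
  set U : E4 := planeEmb y with hU
  set Q : E4 := perpEmb x with hQ
  set Jy : E2 := (WithLp.equiv 2 (Fin 2 → ℝ)).symm ![-y 1, y 0] with hJy
  set W : E4 := planeEmb Jy with hW
  set γ : ℝ → E4 := fun θ => Real.cos θ • U + Real.sin θ • W + Q with hγ
  have hγR : ∀ θ, γ θ = planeEmb
      (((Complex.orthonormalBasisOneI.repr.symm.trans (rotation (Circle.exp θ))).trans Complex.orthonormalBasisOneI.repr) y) +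
      perpEmb x := by
    intro θ
    rw [rotation_family_apply, planeEmb_add, planeEmb_smul, planeEmb_smul]
  have hγ0 : γ 0 = P := by
    simp [hγ, hP, hU, hQ]
  have hγ' : HasDerivAt γ W 0 := by
    have h1 := ((Real.hasDerivAt_cos 0).smul_const U).add ((Real.hasDerivAt_sin 0).smul_const W)
    have h2 := h1.add_const Q
    simp only [Real.sin_zero, neg_zero, zero_smul, Real.cos_zero, one_smul, zero_add] at h2
    exact h2
  -- (3) `θ ↦ A(γ θ)` is constant, so its derivative `Σᵢ Wᵢ ∂ᵢA(P)` vanishes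
  have hconst : ∀ θ, toFun A (γ θ) = toFun A P := by
    intro θ
    rw [hγR θ, ← hsum, ← hsum]
    exact hE _ y x
  have hderiv : HasDerivAt (fun θ => toFun A (γ θ)) (Literature.Analysis.Calculus.MvPoly.derivCLM A (γ 0) W) 0 :=
    (hasFDerivAt_toFun A (γ 0)).comp_hasDerivAt 0 hγ'
  have hzero : Literature.Analysis.Calculus.MvPoly.derivCLM A (γ 0) W = 0 := by
    have h2 : HasDerivAt (fun θ => toFun A (γ θ)) 0 0 := by
      rw [show (fun θ => toFun A (γ θ)) = fun _ => toFun A P from funext hconst]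
      exact hasDerivAt_const _ _
    exact hderiv.unique h2
  rw [hγ0, derivCLM_apply, Fin.sum_univ_four] at hzero
  -- (4) `W = ι(−y₁, y₀) = (−s, t, t, t)/√3` at `P`, so this is the generator identity up to the factor `√3`
  have hW0 : W 0 = -y 1 := by simp [hW, hJy, planeEmb_apply]
  have hW1 : W 1 = y 0 / Real.sqrt 3 := by simp [hW, hJy, planeEmb_apply]
  have hW2 : W 2 = y 0 / Real.sqrt 3 := by simp [hW, hJy, planeEmb_apply]
  have hW3 : W 3 = y 0 / Real.sqrt 3 := by simp [hW, hJy, planeEmb_apply]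
  have hP0 : P 0 = y 0 := planeEmb_add_perpEmb_apply_zero y x
  have hPs : P 1 + P 2 + P 3 = 3 * (y 1 / Real.sqrt 3) := perpEmb_sum y x
  rw [hW0, hW1, hW2, hW3] at hzero
  have hs : Real.sqrt 3 ≠ 0 := by positivity
  have h3 : Real.sqrt 3 * Real.sqrt 3 = 3 := Real.mul_self_sqrt (by norm_num)
  rw [← hx0]
  have e1 : (Fin.succ 0 : Fin 4) = 1 := rfl
  have e2 : (Fin.succ 1 : Fin 4) = 2 := rfl
  have e3 : (Fin.succ 2 : Fin 4) = 3 := rfl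
  simp only [map_sub, map_mul, map_add, eval_X, Fin.sum_univ_three, e1, e2, e3, ← toFun_apply]
  rw [hP0, hPs]
  -- `hzero : -y₁·∂₀A + (y₀/√3)(∂₁A + ∂₂A + ∂₃A) = 0` at `P`; the goal is `√3` times it
  have key : y 0 * (toFun (pderiv 1 A) P + toFun (pderiv 2 A) P + toFun (pderiv 3 A) P) -
      3 * (y 1 / Real.sqrt 3) * toFun (pderiv 0 A) P =
      Real.sqrt 3 * (-y 1 * toFun (pderiv 0 A) P + y 0 / Real.sqrt 3 * toFun (pderiv 1 A) P +
        y 0 / Real.sqrt 3 * toFun (pderiv 2 A) P + y 0 / Real.sqrt 3 * toFun (pderiv 3 A) P) := by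
    field_simp
    linear_combination (y 1 * toFun (pderiv 0 A) P) * h3
  rw [key, hzero, mul_zero]

end Summit.QuantumFields.YangMills.Theorems.F4SubCurvatureDoorTorus

end
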